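import Summits.CriticalPhenomena.CardyFormulaZ2.Theses.CardyIsoradial
import Literature.Probability.Percolation.IsoradialSquareLatticeGMTiling
import Literature.Probability.RandomPlanarGeometry.ImageUnivalent
import Literature.Probability.RandomPlanarGeometry.ZoomFlow

/-!
# Line `lindef_modulus` — crux `CrossingLimitInvariance` (stmt-CriticalPhenomena-0785), ALT skeleton

Strategist's ALTERNATIVE line (never overwrites the live skeleton `Lines/birth.lean`). Route
`route-CriticalPhenomena-CardyIsoradial`, sub-problem `CardyFormulaZ2`; the crux is FIXED and is
concluded BY NAME below (`CrossingLimitInvariance_of`, `CrossingLimitInvariance_proof`).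

## Architecture: universality UP TO A LINEAR DEFORMATION, then rigidity of the modulus

Manolescu (arXiv:2502.08394v2, Ch. 5) re-organises the Duminil-Copin–Kozlowski–Krachun–Manolescu–
Oulamara rotation-invariance proof (arXiv:2012.11672) in two logically separate halves:

* Thm 5.4 ("universality up to linear deformation"): `φ_{δ𝕃(β)}` and `φ_{δ𝕃(α)} ∘ M_{β,α}` are
  `O(δ^c)`-close for SOME invertible LINEAR map `M_{β,α}` — and "Theorem 5.4 only uses qualitative
  features of critical FK-percolation (essentially RSW) and the star–triangle transformation"
  (p. 53): the track-exchange coupling is run WITHOUT knowing that the drift speed of large clusters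
  vanishes; a law of large numbers makes the accumulated drift an asymptotically deterministic
  LINEAR map, absorbed into `M`;
* Thm 5.3 (`M_{π/2,α} = id`, p. 52–53): a SEPARATE identification of the modulus ("necessarily
  involves exact integrability": Bethe-ansatz/transfer-matrix identity (5.3) in DKKMO v1 = their
  Thm 2.4 / Prop 6.16 `v_Top = 0`; or, in the survey, the reflection symmetry of `𝕃(α)` + rotation
  invariance of `𝕃(π/2)`).

The live line `birth` transports crossing probabilities at `o(1)` with the IDENTITY re-embedding at
every stage (GM grid reduction `G → G_{α,β}`, then `G_{α,β} → G_{α',β'}`), so each of its stubs A, B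
silently contains a zero-drift statement for aperiodic track systems. This line instead cuts along
Manolescu's seam, for the WHOLE Grimmett–Manolescu class `𝒢`:

* `stub_gridLinear`  (L1a, XL): every `(G, emb) ∈ 𝒢(ε)` has a hub lattice `G_{α,β} ∈ BAP(ε')`
  (`gmEmbedding α β`, GM arXiv:1204.0505 §4.6/§7) and an orientation-preserving `M₁ ∈ GL₂(ℝ)` such
  that the crude crossing probability of `R` in `G` and of `M₁ R` in the hub differ by `o(1)` —
  GM's grid slide (§7 Lemma "grid slide", §8.4) run at LINEAR-DEFORMATION precision (drift of
  large clusters under the `≍ δ⁻²` star–triangle moves = deterministic linear part + `o(δ⁻¹)`),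
  strictly WEAKER than `birth.stub_gridReduction` (which is the case `M₁ = id`);
* `stub_hubLinear`   (L1b, XL): every hub lattice `G_{α,β} ∈ BAP(ε')` has an orientation-preserving
  `M₂ ∈ GL₂(ℝ)` with crude crossings of `R` in the hub `o(1)`-close to crude crossings of `M₂ R` in
  `ℤ²` (`squareLatticeEmbedding`, itself the hub `G_{-π/4,π/4}`) — Manolescu Thm 5.4 extended from
  constant to arbitrary `BAP` angle sequences (DKKMO's sorting of one family through a homogeneous
  environment + LLN for the drift); strictly WEAKER than `birth.stub_squareGridUniversality ∘
  stub_quadToCrude` (the case `M₂ = id`);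
* `stub_modulus`     (L2, XL, HARDEST — "isoradial = conformal"): for `(G, emb) ∈ 𝒢(ε)`, ANY
  orientation-preserving linear `M` along which `G`'s crude crossing probabilities are `o(1)`-close
  to those of `ℤ²` is an exact similarity `z ↦ a z`. Printed cases: `G = 𝕃(α)` (Manolescu Thm 5.3),
  `G = ℤ²` itself (the group of asymptotic linear symmetries of `P_{1/2}` contains `SO(2)` by DKKMO
  Cor. 1.3, tree fact `dkkmo_crossing_rotation_invariance`, hence contains no non-conformal element
  by RSW: `diag(σ,σ⁻¹)ⁿ` would make long rectangles as crossable as squares); bi-periodic `G`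
  announced ([HM24]); general `G`: the zero-speed identity in inhomogeneous environments (open).

Orientation (`0 < det`) is WLOG for L1a/L1b by the exact reflection symmetry of `P_{1/2}` on `ℤ²`
and of the hub family (a reflected isoradial square lattice is an isoradial square lattice); it is
what lets L2 conclude with a similarity rather than a similarity-or-anti-similarity.

Composition (real proof, no `sorry`): for the source `G` (limits `Φ`) take `M = M₂ ∘ M₁` from
L1a+L1b; L2 makes it `z ↦ a z`; similar rectangles have the same uniformizing real data
(`ConformalRectangle.hasCrossingLimit_iff_of_image_data`, tree, proved), so `ℤ²` has crude crossing
limits `Φ` for EVERY conformal rectangle; for the target `G'` run L1a+L1b+L2 again (`z ↦ a' z`) and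
pull the `ℤ²` limits back. No Literature fact is assumed: `sorryAx` enters only through the three
`Holds.stub_*`.

Disproof / negatives honoured: no `Disproof.lean` exists for this crux (ledger crux ls, 2026-08-17);
`ledger negatives --problem CriticalPhenomena`: no stub mentions `CardyUniversality`, an abstract
Schramm principle, a hand-picked threshold, or two rectangular embeddings of `ℤ²`; L2 is stated
modulo the EXACT similarity group (typing checklist 4c(i): the gauge here is `ℝ₊·SO(2)`, and the
statement is invariant under it).
-/

noncomputable section

namespace Summit.CriticalPhenomena.CardyFormulaZ2.Cruxes.CrossingLimitInvariance.LindefModulus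

open Filter Topology Set
open Literature.Probability.RandomPlanarGeometry (ConformalRectangle similarity similarity_apply)
open Summit.CriticalPhenomena.CardyFormulaZ2.Theses.CardyIsoradial (CrossingLimitInvariance)

/-! ### Vocabulary (abbreviations only; all objects are tree declarations) -/

/-- Crude crossing probability of the conformal rectangle `R` at mesh `δ` for an embedded graph
under its canonical isoradial law: the route's event `embDomainCrossing emb.z R.carrier δ (R.arc 0)
(R.arc 2)` under `emb.isoradialPercolation`. [cite: GrimmettManolescu2014Isoradial, §1–2] -/
abbrev crudeProb {V F : Type} [DecidableEq V] [DecidableEq F] {G : SimpleGraph V} [G.LocallyFinite]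
    (emb : Literature.Probability.LatticeModels.RhombicEmbedding G F) (R : ConformalRectangle)
    (δ : ℝ) : ℝ :=
  emb.isoradialPercolation.real
    (Literature.Probability.Percolation.embDomainCrossing emb.z R.carrier δ (R.arc 0) (R.arc 2))

/-- Crude crossing probability in the reference lattice `ℤ²` (isoradial embedding
`squareLatticeEmbedding = G_{-π/4,π/4}`, canonical law `= P_{1/2}` by the tree theorem
`RhombicEmbedding.isoradialPercolation_squareLattice_holds`). [cite: GrimmettManolescu2014Isoradial, §1] -/
abbrev crudeProbZ2 (R : ConformalRectangle) (δ : ℝ) : ℝ :=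
  crudeProb Literature.Probability.LatticeModels.squareLatticeEmbedding R δ

/-- Positivity of the determinant of a real-linear automorphism of `ℂ ≅ ℝ²` (orientation
preserving). [folklore] -/
abbrev PosDet (M : ℂ ≃L[ℝ] ℂ) : Prop :=
  0 < LinearMap.det (M.toLinearEquiv : ℂ →ₗ[ℝ] ℂ)

/-! ### The three registered stubs (the ONLY `sorry`s of this file) and their by-name handles -/

/-- **Stub L1a — grid reduction at linear-deformation precision (GM §7 grid slide + §8.4, with the
drift of large clusters controlled up to a deterministic LINEAR map; size XL).** Every graph of
the class `𝒢(ε)` has a hub lattice `G_{α,β} ∈ BAP(ε')` and an orientation-preserving real-linear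
`M₁` such that, for every conformal rectangle `R`, the crude crossing probability of `R` in `G`
and of `M₁ R` in the hub differ by `o(1)` as `δ → 0⁺`. Weaker than `birth.stub_gridReduction`
(`M₁ = id`). -/
protected theorem Holds.stub_gridLinear :
    ∀ (V F : Type) [Countable V] [DecidableEq V] [DecidableEq F] (G : SimpleGraph V) [G.LocallyFinite]
      (emb : Literature.Probability.LatticeModels.RhombicEmbedding G F),
      G.Preconnected → emb.IsIsoradial → emb.IsRhombicTiling → emb.HasSquareGridProperty →
      ∀ ε : ℝ, 0 < ε → emb.HasBoundedAngles ε →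
      ∃ (α β : ℤ → ℝ) (ε' : ℝ), 0 < ε' ∧
        (∀ i j : ℤ, 2 * ε' ≤ β j - α i ∧ β j - α i ≤ Real.pi - 2 * ε') ∧
        ∃ M₁ : ℂ ≃L[ℝ] ℂ, 0 < LinearMap.det (M₁.toLinearEquiv : ℂ →ₗ[ℝ] ℂ) ∧
          ∀ R : Literature.Probability.RandomPlanarGeometry.ConformalRectangle,
            Filter.Tendsto
              (fun δ : ℝ =>
                emb.isoradialPercolation.real
                    (Literature.Probability.Percolation.embDomainCrossing emb.z R.carrier δ (R.arc 0)
                      (R.arc 2)) -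
                  (Literature.Probability.Percolation.gmEmbedding α β).isoradialPercolation.real
                    (Literature.Probability.Percolation.embDomainCrossing
                      (Literature.Probability.Percolation.gmEmbedding α β).z
                      (Literature.Probability.RandomPlanarGeometry.MarkedDomain.map R M₁.toHomeomorph).carrier
                      δ
                      ((Literature.Probability.RandomPlanarGeometry.MarkedDomain.map R M₁.toHomeomorph).arc 0)
                      ((Literature.Probability.RandomPlanarGeometry.MarkedDomain.map R M₁.toHomeomorph).arc 2)))
              (nhdsWithin (0 : ℝ) (Set.Ioi 0)) (nhds (0 : ℝ)) := by
  sorry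

/-- By-name handle of the registered stub `Holds.stub_gridLinear`. -/
def stub_gridLinear : Prop := type_of% Holds.stub_gridLinear

/-- **Stub L1b — hub lattices are `ℤ²` up to a linear deformation (Manolescu arXiv:2502.08394 Thm 5.4
extended from constant to arbitrary `BAP` angle sequences; size XL).** Every hub lattice
`G_{α,β} ∈ BAP(ε')` has an orientation-preserving real-linear `M₂` such that, for every conformal
rectangle `R`, the crude crossing probability of `R` in `G_{α,β}` and of `M₂ R` in `ℤ²` differ by
`o(1)`. Printed case: both sequences constant (`𝕃(θ)` up to rotation; there `M₂ = id` by Thm 5.3,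
but this stub does not ask for it). Weaker than `birth.stub_squareGridUniversality` +
`birth.stub_quadToCrude` (`M₂ = id`). -/
protected theorem Holds.stub_hubLinear :
    ∀ (α β : ℤ → ℝ) (ε' : ℝ), 0 < ε' →
      (∀ i j : ℤ, 2 * ε' ≤ β j - α i ∧ β j - α i ≤ Real.pi - 2 * ε') →
      ∃ M₂ : ℂ ≃L[ℝ] ℂ, 0 < LinearMap.det (M₂.toLinearEquiv : ℂ →ₗ[ℝ] ℂ) ∧
        ∀ R : Literature.Probability.RandomPlanarGeometry.ConformalRectangle,
          Filter.Tendsto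
            (fun δ : ℝ =>
              (Literature.Probability.Percolation.gmEmbedding α β).isoradialPercolation.real
                  (Literature.Probability.Percolation.embDomainCrossing
                    (Literature.Probability.Percolation.gmEmbedding α β).z R.carrier δ (R.arc 0) (R.arc 2)) -
                Literature.Probability.LatticeModels.squareLatticeEmbedding.isoradialPercolation.real
                  (Literature.Probability.Percolation.embDomainCrossing
                    Literature.Probability.LatticeModels.squareLatticeEmbedding.z
                    (Literature.Probability.RandomPlanarGeometry.MarkedDomain.map R M₂.toHomeomorph).carrier δ
                    ((Literature.Probability.RandomPlanarGeometry.MarkedDomain.map R M₂.toHomeomorph).arc 0)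
                    ((Literature.Probability.RandomPlanarGeometry.MarkedDomain.map R M₂.toHomeomorph).arc 2)))
            (nhdsWithin (0 : ℝ) (Set.Ioi 0)) (nhds (0 : ℝ)) := by
  sorry

/-- By-name handle of the registered stub `Holds.stub_hubLinear`. -/
def stub_hubLinear : Prop := type_of% Holds.stub_hubLinear

/-- **Stub L2 — rigidity of the modulus ("the isoradial embedding is the conformal embedding";
size XL, HARDEST).** For `(G, emb) ∈ 𝒢(ε)`: every orientation-preserving real-linear `M` along
which the crude crossing probabilities of `G` are `o(1)`-close to those of `ℤ²` (for every
conformal rectangle) is an exact similarity `z ↦ a z`, `a ≠ 0`. Printed cases: `G = 𝕃(α)`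
(Manolescu Thm 5.3 / DKKMO Thm 2.1); `G = ℤ²` (DKKMO Cor 1.3 + RSW); bi-periodic `G` announced
([HM24]); general aperiodic `G`: open (zero drift speed in inhomogeneous environments). -/
protected theorem Holds.stub_modulus :
    ∀ (V F : Type) [Countable V] [DecidableEq V] [DecidableEq F] (G : SimpleGraph V) [G.LocallyFinite]
      (emb : Literature.Probability.LatticeModels.RhombicEmbedding G F),
      G.Preconnected → emb.IsIsoradial → emb.IsRhombicTiling → emb.HasSquareGridProperty →
      ∀ ε : ℝ, 0 < ε → emb.HasBoundedAngles ε →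
      ∀ M : ℂ ≃L[ℝ] ℂ, 0 < LinearMap.det (M.toLinearEquiv : ℂ →ₗ[ℝ] ℂ) →
        (∀ R : Literature.Probability.RandomPlanarGeometry.ConformalRectangle,
          Filter.Tendsto
            (fun δ : ℝ =>
              emb.isoradialPercolation.real
                  (Literature.Probability.Percolation.embDomainCrossing emb.z R.carrier δ (R.arc 0)
                    (R.arc 2)) -
                Literature.Probability.LatticeModels.squareLatticeEmbedding.isoradialPercolation.real
                  (Literature.Probability.Percolation.embDomainCrossing
                    Literature.Probability.LatticeModels.squareLatticeEmbedding.z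
                    (Literature.Probability.RandomPlanarGeometry.MarkedDomain.map R M.toHomeomorph).carrier δ
                    ((Literature.Probability.RandomPlanarGeometry.MarkedDomain.map R M.toHomeomorph).arc 0)
                    ((Literature.Probability.RandomPlanarGeometry.MarkedDomain.map R M.toHomeomorph).arc 2)))
            (nhdsWithin (0 : ℝ) (Set.Ioi 0)) (nhds (0 : ℝ))) →
        ∃ a : ℂ, a ≠ 0 ∧ ∀ z : ℂ, M z = a * z := by
  sorry

/-- By-name handle of the registered stub `Holds.stub_modulus`. -/
def stub_modulus : Prop := type_of% Holds.stub_modulus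

/-! ### Folded forms of the stubs (definitional unfolding of the abbreviations; proved by `id`) -/

/-- `stub_gridLinear` in the file's vocabulary. [folklore] -/
theorem gridLinear_folded (h : stub_gridLinear) :
    ∀ (V F : Type) [Countable V] [DecidableEq V] [DecidableEq F] (G : SimpleGraph V) [G.LocallyFinite]
      (emb : Literature.Probability.LatticeModels.RhombicEmbedding G F),
      G.Preconnected → emb.IsIsoradial → emb.IsRhombicTiling → emb.HasSquareGridProperty →
      ∀ ε : ℝ, 0 < ε → emb.HasBoundedAngles ε →
      ∃ (α β : ℤ → ℝ) (ε' : ℝ), 0 < ε' ∧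
        (∀ i j : ℤ, 2 * ε' ≤ β j - α i ∧ β j - α i ≤ Real.pi - 2 * ε') ∧
        ∃ M₁ : ℂ ≃L[ℝ] ℂ, PosDet M₁ ∧
          ∀ R : ConformalRectangle,
            Tendsto
              (fun δ : ℝ =>
                crudeProb emb R δ -
                  crudeProb (Literature.Probability.Percolation.gmEmbedding α β)
                    (R.map M₁.toHomeomorph) δ)
              (𝓝[>] (0 : ℝ)) (𝓝 (0 : ℝ)) :=
  h

/-- `stub_hubLinear` in the file's vocabulary. [folklore] -/
theorem hubLinear_folded (h : stub_hubLinear) :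
    ∀ (α β : ℤ → ℝ) (ε' : ℝ), 0 < ε' →
      (∀ i j : ℤ, 2 * ε' ≤ β j - α i ∧ β j - α i ≤ Real.pi - 2 * ε') →
      ∃ M₂ : ℂ ≃L[ℝ] ℂ, PosDet M₂ ∧
        ∀ R : ConformalRectangle,
          Tendsto
            (fun δ : ℝ =>
              crudeProb (Literature.Probability.Percolation.gmEmbedding α β) R δ -
                crudeProbZ2 (R.map M₂.toHomeomorph) δ)
            (𝓝[>] (0 : ℝ)) (𝓝 (0 : ℝ)) :=
  h

/-- `stub_modulus` in the file's vocabulary. [folklore] -/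
theorem modulus_folded (h : stub_modulus) :
    ∀ (V F : Type) [Countable V] [DecidableEq V] [DecidableEq F] (G : SimpleGraph V) [G.LocallyFinite]
      (emb : Literature.Probability.LatticeModels.RhombicEmbedding G F),
      G.Preconnected → emb.IsIsoradial → emb.IsRhombicTiling → emb.HasSquareGridProperty →
      ∀ ε : ℝ, 0 < ε → emb.HasBoundedAngles ε →
      ∀ M : ℂ ≃L[ℝ] ℂ, PosDet M →
        (∀ R : ConformalRectangle,
          Tendsto (fun δ : ℝ => crudeProb emb R δ - crudeProbZ2 (R.map M.toHomeomorph) δ)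
            (𝓝[>] (0 : ℝ)) (𝓝 (0 : ℝ))) →
        ∃ a : ℂ, a ≠ 0 ∧ ∀ z : ℂ, M z = a * z :=
  h

/-! ### Glue lemmas (proved) -/

/-- The determinant of a composite of orientation-preserving maps is positive. [folklore] -/
theorem posDet_trans {M₁ M₂ : ℂ ≃L[ℝ] ℂ} (h₁ : PosDet M₁) (h₂ : PosDet M₂) : PosDet (M₁.trans M₂) := by
  have : ((M₁.trans M₂).toLinearEquiv : ℂ →ₗ[ℝ] ℂ) =
      (M₂.toLinearEquiv : ℂ →ₗ[ℝ] ℂ).comp (M₁.toLinearEquiv : ℂ →ₗ[ℝ] ℂ) := by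
    ext z
    simp
  dsimp only [PosDet]
  rw [this, LinearMap.det_comp]
  exact mul_pos h₂ h₁

/-- Crude crossing probabilities only see the carrier and the two arcs: mapping a rectangle by
`e₁` then `e₂` or by `e₁.trans e₂` gives the same number. [folklore] -/
theorem crudeProb_map_map {V F : Type} [DecidableEq V] [DecidableEq F] {G : SimpleGraph V}
    [G.LocallyFinite] (emb : Literature.Probability.LatticeModels.RhombicEmbedding G F)
    (R : ConformalRectangle) (e₁ e₂ : ℂ ≃ₜ ℂ) (δ : ℝ) :
    crudeProb emb ((R.map e₁).map e₂) δ = crudeProb emb (R.map (e₁.trans e₂)) δ := by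
  simp [crudeProb, Set.image_image]

/-- Undoing a similarity: for `M = (a · )`, the rectangle `(a⁻¹ R)` mapped by `M` has the carrier
and arcs of `R`, hence the same crude crossing probabilities. [folklore] -/
theorem crudeProb_map_inv_map {V F : Type} [DecidableEq V] [DecidableEq F] {G : SimpleGraph V}
    [G.LocallyFinite] (emb : Literature.Probability.LatticeModels.RhombicEmbedding G F)
    {M : ℂ ≃L[ℝ] ℂ} {a : ℂ} (ha : a ≠ 0) (hM : ∀ z, M z = a * z) (R : ConformalRectangle) (δ : ℝ) :
    crudeProb emb ((R.map (similarity a⁻¹ (inv_ne_zero ha) 0)).map M.toHomeomorph) δ =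
      crudeProb emb R δ := by
  simp [crudeProb, Set.image_image, hM, mul_inv_cancel_left₀ ha]

/-- Transfer of crossing limits between a rectangle and its image under `z ↦ a z` (same real
uniformizing data; tree `ConformalRectangle.hasCrossingLimit_iff_of_image_data`). [folklore] -/
theorem hasCrossingLimit_iff_mul {a : ℂ} (ha : a ≠ 0) {R S : ConformalRectangle}
    (hS : S.carrier = (fun z => a * z) '' R.carrier) (hpt : ∀ i, S.pt i = a * R.pt i)
    (p F : ℝ → ℝ) : S.HasCrossingLimit p F ↔ R.HasCrossingLimit p F :=
  ConformalRectangle.hasCrossingLimit_iff_of_image_data (h := fun z => a * z)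
    ((differentiable_id.const_mul a).differentiableOn) (fun _ _ _ _ h => mul_left_cancel₀ ha h)
    (continuous_const.mul continuous_id).continuousOn hS hpt

/-- From L1a + L1b: every `(G, emb) ∈ 𝒢(ε)` is `o(1)`-close to `ℤ²` along SOME orientation-preserving
linear map (compose the two deformations). [folklore] -/
theorem linear_to_Z2 (hA : stub_gridLinear) (hB : stub_hubLinear)
    {V F : Type} [Countable V] [DecidableEq V] [DecidableEq F] (G : SimpleGraph V) [G.LocallyFinite]
    (emb : Literature.Probability.LatticeModels.RhombicEmbedding G F)
    (hpre : G.Preconnected) (hiso : emb.IsIsoradial) (htile : emb.IsRhombicTiling)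
    (hsgp : emb.HasSquareGridProperty) {ε : ℝ} (hε : 0 < ε) (hbap : emb.HasBoundedAngles ε) :
    ∃ M : ℂ ≃L[ℝ] ℂ, PosDet M ∧ ∀ R : ConformalRectangle,
      Tendsto (fun δ : ℝ => crudeProb emb R δ - crudeProbZ2 (R.map M.toHomeomorph) δ)
        (𝓝[>] (0 : ℝ)) (𝓝 (0 : ℝ)) := by
  obtain ⟨α, β, ε', hε', hang, M₁, hM₁, h₁⟩ :=
    gridLinear_folded hA V F G emb hpre hiso htile hsgp ε hε hbap
  obtain ⟨M₂, hM₂, h₂⟩ := hubLinear_folded hB α β ε' hε' hang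
  refine ⟨M₁.trans M₂, posDet_trans hM₁ hM₂, fun R => ?_⟩
  have key := (h₁ R).add (h₂ (R.map M₁.toHomeomorph))
  rw [add_zero] at key
  refine key.congr' (Eventually.of_forall fun δ => ?_)
  have hmm : crudeProbZ2 ((R.map M₁.toHomeomorph).map M₂.toHomeomorph) δ =
      crudeProbZ2 (R.map (M₁.trans M₂).toHomeomorph) δ := by
    rw [crudeProbZ2, crudeProb_map_map]
    rfl
  show _ = crudeProb emb R δ - crudeProbZ2 (R.map (M₁.trans M₂).toHomeomorph) δ
  rw [← hmm]
  ring

/-- From L1a + L1b + L2: every `(G, emb) ∈ 𝒢(ε)` is `o(1)`-close to `ℤ²` along an exact similarity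
`z ↦ a z`. [folklore] -/
theorem similar_to_Z2 (hA : stub_gridLinear) (hB : stub_hubLinear) (hC : stub_modulus)
    {V F : Type} [Countable V] [DecidableEq V] [DecidableEq F] (G : SimpleGraph V) [G.LocallyFinite]
    (emb : Literature.Probability.LatticeModels.RhombicEmbedding G F)
    (hpre : G.Preconnected) (hiso : emb.IsIsoradial) (htile : emb.IsRhombicTiling)
    (hsgp : emb.HasSquareGridProperty) {ε : ℝ} (hε : 0 < ε) (hbap : emb.HasBoundedAngles ε) :
    ∃ (M : ℂ ≃L[ℝ] ℂ) (a : ℂ), a ≠ 0 ∧ (∀ z, M z = a * z) ∧ ∀ R : ConformalRectangle,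
      Tendsto (fun δ : ℝ => crudeProb emb R δ - crudeProbZ2 (R.map M.toHomeomorph) δ)
        (𝓝[>] (0 : ℝ)) (𝓝 (0 : ℝ)) := by
  obtain ⟨M, hdet, hM⟩ := linear_to_Z2 hA hB G emb hpre hiso htile hsgp hε hbap
  obtain ⟨a, ha, hMa⟩ := modulus_folded hC V F G emb hpre hiso htile hsgp ε hε hbap M hdet hM
  exact ⟨M, a, ha, hMa, hM⟩

/-! ### Composition (sorry-free): the three stubs imply the crux BY NAME -/

/-- **The composition (real proof).** Source: `G ∈ 𝒢(ε)` with crossing limits `Φ`; by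
`similar_to_Z2`, `G` is `o(1)`-close to `ℤ²` along `z ↦ a z`, so `ℤ²` has crude crossing limits `Φ`
for every conformal rectangle (apply the hypothesis to `a⁻¹ R''` and transfer the uniformizing data
along the similarity). Target: `G' ∈ 𝒢(ε')` is `o(1)`-close to `ℤ²` along `z ↦ a' z`; pull the
`ℤ²` limits of `a' R` back to `R`. -/
theorem CrossingLimitInvariance_of :
    stub_gridLinear → stub_hubLinear → stub_modulus → CrossingLimitInvariance := by
  intro hA hB hC Φ V F _ _ _ G _ emb hpre hiso htile hsgp ε hε hbap hΦ V' F' _ _ _ G' _ emb' hpre'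
    hiso' htile' hsgp' ε' hε' hbap'
  -- Step 1 (source): ℤ² has crude crossing limits Φ for every conformal rectangle.
  obtain ⟨M, a, ha, hMa, hM⟩ := similar_to_Z2 hA hB hC G emb hpre hiso htile hsgp hε hbap
  have hZ : ∀ S : ConformalRectangle, S.HasCrossingLimit (fun δ => crudeProbZ2 S δ) Φ := by
    intro S
    set R : ConformalRectangle := S.map (similarity a⁻¹ (inv_ne_zero ha) 0) with hR
    -- limits of G at R, moved to ℤ² at (R mapped by M) = S
    have hRlim : R.HasCrossingLimit (fun δ => crudeProbZ2 S δ) Φ := by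
      intro φ x hφx
      have h0 : Tendsto (fun δ => crudeProb emb R δ) (𝓝[>] (0 : ℝ)) (𝓝 (Φ _)) := hΦ R φ x hφx
      have h1 := hM R
      have key := h0.sub h1
      rw [sub_zero] at key
      refine key.congr' (Eventually.of_forall fun δ => ?_)
      have : crudeProbZ2 (R.map M.toHomeomorph) δ = crudeProbZ2 S δ := by
        rw [hR, crudeProbZ2, crudeProbZ2, crudeProb_map_inv_map _ ha hMa]
      show _ = crudeProbZ2 S δ
      rw [← this]
      ring
    -- S is the image of R under z ↦ a z
    have hS : S.carrier = (fun z => a * z) '' R.carrier := by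
      rw [hR]
      simp [Set.image_image, mul_inv_cancel_left₀ ha]
    have hpt : ∀ i, S.pt i = a * R.pt i := by
      intro i
      rw [hR]
      simp [mul_inv_cancel_left₀ ha]
    exact (hasCrossingLimit_iff_mul ha hS hpt _ Φ).2 hRlim
  -- Step 2 (target): pull the ℤ² limits back to G'.
  obtain ⟨M', a', ha', hMa', hM'⟩ :=
    similar_to_Z2 hA hB hC G' emb' hpre' hiso' htile' hsgp' hε' hbap'
  intro R φ x hφx
  have hS : (R.map M'.toHomeomorph).carrier = (fun z => a' * z) '' R.carrier := by
    simp [hMa']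
  have hpt : ∀ i, (R.map M'.toHomeomorph).pt i = a' * R.pt i := by
    intro i
    simp [hMa']
  have hRZ : R.HasCrossingLimit (fun δ => crudeProbZ2 (R.map M'.toHomeomorph) δ) Φ :=
    (hasCrossingLimit_iff_mul ha' hS hpt _ Φ).1 (hZ _)
  have h0 := hRZ φ x hφx
  have h1 := hM' R
  have key := h1.add h0
  rw [zero_add] at key
  refine key.congr' (Eventually.of_forall fun δ => ?_)
  change _ = crudeProb emb' R δ
  ring

/-- **The crux BY NAME from the three stubs** (depends on `sorryAx` ONLY through
`Holds.stub_gridLinear`, `Holds.stub_hubLinear`, `Holds.stub_modulus`). -/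
theorem CrossingLimitInvariance_proof : CrossingLimitInvariance :=
  CrossingLimitInvariance_of Holds.stub_gridLinear Holds.stub_hubLinear Holds.stub_modulus

end Summit.CriticalPhenomena.CardyFormulaZ2.Cruxes.CrossingLimitInvariance.LindefModulus

end
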